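import Summits.AnomalousDissipation.AnomalousDissipation.Theorems.SolenoidalFractalHomogenisationLagrangianStepVmodSfHighW7
import Summits.AnomalousDissipation.AnomalousDissipation.Theorems.SolenoidalFractalHomogenisationLagrangianStepVmodSfTexts
import HarnessLib

/-!
# K1L_D (stmt-AnomalousDissipation-27980): (V_mod) flat stage, block (sf) — THE HIGH-LABEL ROWS of `VmodFlat.SFMode_textEVH`
# (prover ad-k3l-bookkeeping-p1 g10, (sf) owner by RULING D28-5; helper `--supports 27980 --as helper`)

Rows «H / high / τ > P» and «M (νh ≤ ν)» of the certifier's table (`Lines/onelevel-ss-regimes.md` §3, §4 (sf); shape R-check 11:46Z) for the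
per-label sideband text `SFMode_textEVH e` (`…VmodSfTexts`, p717306): for every split parameter `g₀ ∈ (0,1]` and every HIGH label
`g₀·n ≤ ‖ℓ‖·⌈K/ν⌉` the W7 family is instantiated ONCE at `Kb := (K+1)/g₀` (constants `CK, cK, νh` then ν-free), and

* `ν < νh`: `‖U s t w‖ ≤ √CK·e^{cK·M·Wp}·e^{−cK·ν·(t−s)}‖w‖` (`VmodGen.norm_apply_le_of_highLabelDecay_anyPhase`, p718623 — GENERAL phase) is
  below `C₂·(P/(t−s))^{eσ}·√d_H` because `e^{−a/x} ≤ √x/√a ≤ x^{eσ}/√a` for `x = P/(t−s) ∈ (0,1)` — **this uses `e σ ≤ 1/2`** (certifier's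
  «KEEP EXPLICIT (1)»); `d_H := 1 − exp(−8π²·c·lo·g₀²·M·Wp/(Λ(K+1)²))` bounds the datum weight `dW` from below on high labels past one period;
* `νh ≤ ν (< ν₀ ≤ 1)`: the FLOOR pays — `1 ≤ C₂²·ν^{eσ}·√d_H` since `ν^{eσ} ≥ √ν ≥ √νh` (again `e σ ≤ 1/2`).
Main statement **`sfMode_high`**: the `SFMode_textEVH`-shaped conclusion for all high labels with
`C₂ := √CK·exp(cK·M·Wp)/(√(cK·M·Wp)·√d_H) + 1/(νh·d_H) + 1` — free of `n, ν, ℓ, s, t` (certifier's «KEEP EXPLICIT (2)»).  No (V), no `T`, no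
fastness of the test is used on high labels.  `sorry`-free; NOT a proof of (sf) (the coarse rows consume (V) via T-I), of the stub, of K1L_D
or of AD; rung F-D1.A0.
-/

set_option linter.dupNamespace false

noncomputable section

namespace Summit.AnomalousDissipation.AnomalousDissipation.Theorems.SolenoidalFractalHomogenisation.LagrangianStep.VmodFlat

open Set MeasureTheory Complex UnitAddTorus Filter Topology
open scoped InnerProductSpace ENNReal
open Literature.Analysis Literature.Analysis.FunctionSpaces Literature.Analysis.FunctionSpaces.Torus
open Literature.Analysis.FluidPDE Literature.Analysis.FluidPDE.Torus Literature.Analysis.FluidPDE.LatticeShear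
open Summit.AnomalousDissipation.AnomalousDissipation.Theorems.SolenoidalFractalHomogenisation.LagrangianStep.CellClauseMod
open Summit.AnomalousDissipation.AnomalousDissipation.Theorems.SolenoidalFractalHomogenisation.LagrangianStep.VmodGen
  (norm_apply_le_of_highLabelDecay_anyPhase)

/-! ## §1 Real-variable lemmas -/

/-- `√y ≤ exp y` for `y ≥ 0`. [folklore] -/
theorem sqrt_le_exp {y : ℝ} (hy : 0 ≤ y) : Real.sqrt y ≤ Real.exp y := by
  have h1 : Real.sqrt y ≤ y + 1 := by
    rw [Real.sqrt_le_iff]; exact ⟨by linarith, by nlinarith⟩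
  exact h1.trans (Real.add_one_le_exp y)

/-- The exponential kill against the power cap: for `a > 0`, `0 < x ≤ 1`, `e ≤ 1/2`:
`exp(−a/x) ≤ x^e/√a`. [folklore] -/
theorem exp_neg_div_le_rpow_div_sqrt {a x e : ℝ} (ha : 0 < a) (hx : 0 < x) (hx1 : x ≤ 1) (he1 : e ≤ 1 / 2) :
    Real.exp (-(a / x)) ≤ x ^ e / Real.sqrt a := by
  have hax : 0 < a / x := div_pos ha hx
  -- `exp(−a/x) ≤ 1/√(a/x) = √x/√a`
  have h1 : Real.exp (-(a / x)) ≤ 1 / Real.sqrt (a / x) := by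
    rw [Real.exp_neg, one_div]
    exact inv_anti₀ (Real.sqrt_pos.2 hax) (sqrt_le_exp hax.le)
  have h2 : 1 / Real.sqrt (a / x) = Real.sqrt x / Real.sqrt a := by
    rw [Real.sqrt_div' a hx.le, one_div, inv_div]
  -- `√x = x^{1/2} ≤ x^e` on `(0,1]`
  have h3 : Real.sqrt x ≤ x ^ e := by
    rw [Real.sqrt_eq_rpow]
    exact Real.rpow_le_rpow_of_exponent_ge hx hx1 he1
  rw [h2] at h1
  exact h1.trans (div_le_div_of_nonneg_right h3 (Real.sqrt_nonneg a))

/-- `⌈K/ν⌉·ν ≤ K + 1` for `0 < ν ≤ 1`, `0 ≤ K`. [folklore] -/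
theorem ceil_mul_le {K ν : ℝ} (hK : 0 ≤ K) (hν : 0 < ν) (hν1 : ν ≤ 1) : (⌈K / ν⌉₊ : ℝ) * ν ≤ K + 1 := by
  have h := Nat.ceil_lt_add_one (div_nonneg hK hν.le)
  have h2 : (⌈K / ν⌉₊ : ℝ) * ν ≤ (K / ν + 1) * ν := mul_le_mul_of_nonneg_right h.le hν.le
  have h3 : (K / ν + 1) * ν = K + ν := by field_simp
  linarith

/-! ## §2 The high-label rows -/

set_option maxHeartbeats 3200000 in
/-- **THE HIGH-LABEL ROWS OF `SFMode_textEVH e`** (general phase; W7 at `Kb = (K+1)/g₀`; floor for `ν ≥ νh`).  For every `g₀ ∈ (0,1]` and every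
exponent map with `0 < e σ ≤ 1/2`: the guards of `Bsf_textEVH` and the W7 family give `C₂ ≥ 0` (free of `n, ν, ℓ, s, t`) such that for every cell
member `U` in the regime of `BlockBound`, every LONG window `M·W.period/ν < t − s`, every nonzero slow label with `g₀·n ≤ ‖ℓ‖·⌈K/ν⌉`, every
pair datum `w` carried by `{ℓ,−ℓ}` and EVERY test `ζ`:  `|⟪U s t w, ζ⟫| ≤ η(t−s)·√(dW lo Λ c ν n (t−s) ℓ)·‖w‖·‖ζ‖`. -/
theorem sfMode_high (e : ℝ → ℝ) (he : ∀ σ, 0 < σ → 0 < e σ ∧ e σ ≤ 1 / 2) {g₀ : ℝ} (hg₀ : 0 < g₀) (hg₀1 : g₀ ≤ 1)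
    {k : ℕ} (W : LatticeShear.LatticeWord k) (M : ℝ) (hM : 0 < M) {c : ℝ} (hc : 0 < c) {lo hi Λ β σ ν₀ K : ℝ}
    (hlo : 0 < lo) (hhi : 1 ≤ hi) (hΛ : 1 < Λ) (hσ : 0 < σ) (hν₀1 : ν₀ ≤ 1) (hK : 0 < K)
    (hH : ∀ Kb : ℝ, 1 ≤ Kb → ∃ CK : ℝ, 1 ≤ CK ∧ ∃ cK > (0:ℝ), ∃ νh > (0:ℝ), HighLabelDecayW W M hM lo hi Λ β νh Kb CK cK) :
    ∃ C₂ : ℝ, 0 ≤ C₂ ∧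
    ∀ ν, ∀ hν : ν ∈ Set.Ioo 0 ν₀, ∀ n : ℕ, (⌈K / ν⌉₊ : ℝ) ≤ n → ∀ 𝔸 : Torus.Visc4 (Fin 3),
      Torus.OddSmall 𝔸 (ν * β) → (∃ lam ∈ Set.Icc (1:ℝ) Λ, Torus.NearIso 𝔸 (ν * (lo / lam)) (ν * (hi * lam))) →
      ∀ Tw > (0:ℝ), ∀ U : ℝ → ℝ → (V2 →L[ℝ] V2),
        Torus.IsPropagator Tw (cellField W M hM ν hν.1 n) ((1 / (n:ℝ) ^ 2) • 𝔸) U →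
      ∀ s t : ℝ, 0 ≤ s → s < t → t ≤ Tw → M * W.period / ν < t - s →
      ∀ ℓ ∈ (Torus.freqBall (d := Fin 3) (n / 4)).erase 0, g₀ * n ≤ ‖Torus.latticeVec ℓ‖ * (⌈K / ν⌉₊ : ℝ) →
      ∀ w : V2, (∀ k', k' ≠ ℓ → k' ≠ -ℓ → fc w k' = 0) → ∀ ζ : V2,
        |⟪U s t w, ζ⟫_ℝ|
          ≤ (C₂ * (C₂ * (ν ^ e σ + ((⌈K / ν⌉₊ : ℝ) / n) ^ e σ) + (min 1 ((M * W.period / ν) / (t - s))) ^ e σ))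
            * Real.sqrt (dW lo Λ c ν n (t - s) ℓ) * ‖w‖ * ‖ζ‖ := by
  classical
  obtain ⟨-, he1⟩ := he σ hσ
  have hΛ0 : 0 < Λ := by linarith
  have hΛ1 : 1 ≤ Λ := hΛ.le
  have hWp : 0 < W.period :=
    Summit.AnomalousDissipation.AnomalousDissipation.Theorems.SolenoidalFractalHomogenisation.PermissibleCarrier.period_pos W
  -- ### the W7 instance at `Kb = (K+1)/g₀`
  have hKb : (1:ℝ) ≤ (K + 1) / g₀ := by rw [le_div_iff₀ hg₀]; linarith
  obtain ⟨CK, hCK1, cK, hcK, νh, hνh, hW7⟩ := hH ((K + 1) / g₀) hKb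
  have hCK0 : 0 ≤ CK := by linarith
  -- ### the constants
  set a : ℝ := cK * (M * W.period) with ha
  have ha0 : 0 < a := by rw [ha]; positivity
  set rH : ℝ := 8 * Real.pi ^ 2 * c * lo * g₀ ^ 2 * (M * W.period) / (Λ * (K + 1) ^ 2) with hrH
  have hrH0 : 0 < rH := by rw [hrH]; positivity
  set dH : ℝ := 1 - Real.exp (-rH) with hdH
  have hdH0 : 0 < dH := by rw [hdH]; have := Real.exp_lt_one_iff.2 (neg_neg_of_pos hrH0); linarith
  have hdH1 : dH ≤ 1 := by rw [hdH]; have := Real.exp_pos (-rH); linarith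
  have hsdH : 0 < Real.sqrt dH := Real.sqrt_pos.2 hdH0
  set C₂ : ℝ := Real.sqrt CK * Real.exp a / (Real.sqrt a * Real.sqrt dH) + 1 / (νh * dH) + 1 with hC₂
  have hC₂a : Real.sqrt CK * Real.exp a / (Real.sqrt a * Real.sqrt dH) ≤ C₂ := by
    rw [hC₂]; have : 0 ≤ 1 / (νh * dH) := by positivity
    linarith
  have hC₂b : 1 / (νh * dH) ≤ C₂ := by
    rw [hC₂]; have : 0 ≤ Real.sqrt CK * Real.exp a / (Real.sqrt a * Real.sqrt dH) := by positivity
    linarith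
  have hC₂1 : 1 ≤ C₂ := by
    rw [hC₂]; have : 0 ≤ Real.sqrt CK * Real.exp a / (Real.sqrt a * Real.sqrt dH) := by positivity
    have : 0 ≤ 1 / (νh * dH) := by positivity
    linarith
  have hC₂0 : 0 ≤ C₂ := by linarith
  refine ⟨C₂, hC₂0, ?_⟩
  intro ν hν n hn 𝔸 hodd hwin Tw hTw U hU s t hs hst htT hlong ℓ hℓ hhigh w hws ζ
  -- ### bookkeeping
  have hν1 : ν ≤ 1 := by linarith [hν.2]
  have hn1 : (1:ℝ) ≤ n := by
    have h1 : (1:ℝ) ≤ ⌈K / ν⌉₊ := by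
      have : 0 < K / ν := div_pos hK hν.1
      exact_mod_cast Nat.one_le_iff_ne_zero.2 (Nat.pos_iff_ne_zero.1 (Nat.ceil_pos.2 this))
    exact h1.trans hn
  have hnpos : 0 < n := by exact_mod_cast (show (0:ℝ) < n by linarith)
  have hn1' : 1 ≤ n := hnpos
  have hn0 : (0:ℝ) < n := by exact_mod_cast hnpos
  have hτ : 0 < t - s := sub_pos.2 hst
  have hν0 : 0 < ν := hν.1
  have hν0' : ν ≠ 0 := ne_of_gt hν0
  set P : ℝ := M * W.period / ν with hP
  have hP0 : 0 < P := by rw [hP]; positivity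
  have hνP : ν * P = M * W.period := by rw [hP]; field_simp
  have hντ : M * W.period < ν * (t - s) := by
    have := mul_lt_mul_of_pos_left hlong hν.1
    rwa [hνP] at this
  -- the label
  have hℓ0 : ℓ ≠ 0 := Finset.ne_of_mem_erase hℓ
  have hℓball := Finset.mem_of_mem_erase hℓ
  have hLpos : 0 < ‖Torus.latticeVec ℓ‖ := by
    rcases (norm_nonneg (Torus.latticeVec ℓ)).eq_or_lt with h0 | h0
    · exfalso; apply hℓ0
      have hz : FunctionSpaces.Torus.freqNormSq ℓ = 0 := by rw [← norm_latticeVec_sq', ← h0]; ring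
      unfold FunctionSpaces.Torus.freqNormSq at hz
      have hall := (Finset.sum_eq_zero_iff_of_nonneg fun i _ => sq_nonneg ((ℓ i : ℝ))).1 hz
      funext i
      have := hall i (Finset.mem_univ i)
      exact_mod_cast pow_eq_zero_iff two_ne_zero |>.1 this
    · exact h0
  have hℓn : 2 * ‖Torus.latticeVec ℓ‖ ≤ n := by
    have h1 : FunctionSpaces.Torus.freqNormSq ℓ ≤ (((n / 4 : ℕ) : ℝ)) ^ 2 := FunctionSpaces.Torus.mem_freqBall.1 hℓball
    have h2 : (((n / 4 : ℕ) : ℝ)) ≤ (n:ℝ) / 4 := by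
      have : ((n / 4 : ℕ) : ℝ) * 4 ≤ n := by exact_mod_cast Nat.div_mul_le_self n 4
      linarith
    have h3 : ‖Torus.latticeVec ℓ‖ ^ 2 ≤ ((n:ℝ) / 4) ^ 2 := by
      rw [norm_latticeVec_sq']; exact h1.trans (pow_le_pow_left₀ (Nat.cast_nonneg _) h2 2)
    have h4 : ‖Torus.latticeVec ℓ‖ ≤ (n:ℝ) / 4 := by
      nlinarith [norm_nonneg (Torus.latticeVec ℓ), sq_nonneg (‖Torus.latticeVec ℓ‖ - (n:ℝ) / 4)]
    linarith
  have hKL : (n : ℝ) * ν ≤ (K + 1) / g₀ * ‖Torus.latticeVec ℓ‖ := by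
    -- `g₀ n ν ≤ ‖ℓ‖ ⌈K/ν⌉ ν ≤ ‖ℓ‖ (K+1)`
    have h1 := ceil_mul_le hK.le hν.1 hν1
    have h2 : g₀ * n * ν ≤ ‖Torus.latticeVec ℓ‖ * ((⌈K / ν⌉₊ : ℝ) * ν) := by
      have := mul_le_mul_of_nonneg_right hhigh hν.1.le
      linarith [this]
    have h3 : ‖Torus.latticeVec ℓ‖ * ((⌈K / ν⌉₊ : ℝ) * ν) ≤ ‖Torus.latticeVec ℓ‖ * (K + 1) := mul_le_mul_of_nonneg_left h1 (norm_nonneg _)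
    rw [div_mul_eq_mul_div, le_div_iff₀ hg₀]
    nlinarith
  have hwcp : ∀ k', fc w k' ≠ 0 → (∀ i, (n:ℤ) ∣ k' i - ℓ i) ∨ (∀ i, (n:ℤ) ∣ k' i + ℓ i) := by
    intro k' hk'
    by_cases h1 : k' = ℓ
    · exact Or.inl fun i => by rw [h1, sub_self]; exact dvd_zero _
    · by_cases h2 : k' = -ℓ
      · exact Or.inr fun i => by rw [h2, Pi.neg_apply, neg_add_cancel]; exact dvd_zero _
      · exact absurd (hws k' h1 h2) hk'
  -- ### the allowance pieces
  set X : ℝ := ν ^ e σ + ((⌈K / ν⌉₊ : ℝ) / n) ^ e σ with hX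
  have hX0 : 0 ≤ X := by
    have h1 : 0 ≤ ν ^ e σ := Real.rpow_nonneg hν.1.le _
    have h2 : 0 ≤ ((⌈K / ν⌉₊ : ℝ) / n) ^ e σ := Real.rpow_nonneg (by positivity) _
    rw [hX]; linarith
  set x : ℝ := P / (t - s) with hx
  have hx0 : 0 < x := by rw [hx]; positivity
  have hx1 : x ≤ 1 := by rw [hx, div_le_one hτ]; exact hlong.le
  have hmin : min 1 (P / (t - s)) = x := by rw [hx]; exact min_eq_right hx1
  set η : ℝ := C₂ * (C₂ * X + x ^ e σ) with hη
  have hxe0 : 0 ≤ x ^ e σ := Real.rpow_nonneg hx0.le _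
  have hη_floor : C₂ * (C₂ * ν ^ e σ) ≤ η := by
    rw [hη, hX]
    have h2 : 0 ≤ ((⌈K / ν⌉₊ : ℝ) / n) ^ e σ := Real.rpow_nonneg (by positivity) _
    nlinarith [mul_nonneg hC₂0 (mul_nonneg hC₂0 h2), mul_nonneg hC₂0 hxe0]
  have hη_cap : C₂ * x ^ e σ ≤ η := by
    rw [hη]; nlinarith [mul_nonneg hC₂0 (mul_nonneg hC₂0 hX0)]
  have hη0 : 0 ≤ η := le_trans (by positivity) hη_cap
  -- ### the datum weight on a high label past one period: `dH ≤ dW`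
  have hdW : dH ≤ dW lo Λ c ν n (t - s) ℓ := by
    have hloΛ : 0 < lo / Λ := div_pos hlo hΛ0
    -- `(g₀ν/(K+1))² ≤ |ℓ|²/n²` from `g₀ n ≤ ‖ℓ‖ ⌈K/ν⌉` and `⌈K/ν⌉ ν ≤ K+1`
    have hℓn2 : g₀ * ν / (K + 1) ≤ ‖Torus.latticeVec ℓ‖ / n := by
      have h1 := ceil_mul_le hK.le hν0 hν1
      rw [div_le_div_iff₀ (by linarith) hn0]
      calc g₀ * ν * n = g₀ * n * ν := by ring
        _ ≤ ‖Torus.latticeVec ℓ‖ * (⌈K / ν⌉₊ : ℝ) * ν := mul_le_mul_of_nonneg_right hhigh hν0.le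
        _ = ‖Torus.latticeVec ℓ‖ * ((⌈K / ν⌉₊ : ℝ) * ν) := by ring
        _ ≤ ‖Torus.latticeVec ℓ‖ * (K + 1) := mul_le_mul_of_nonneg_left h1 (norm_nonneg _)
    have hQ : (g₀ * ν / (K + 1)) ^ 2 ≤ FunctionSpaces.Torus.freqNormSq ℓ / (n:ℝ) ^ 2 := by
      have h := pow_le_pow_left₀ (by positivity : 0 ≤ g₀ * ν / (K + 1)) hℓn2 2
      rwa [div_pow ‖Torus.latticeVec ℓ‖ (n:ℝ) 2, norm_latticeVec_sq'] at h
    have hB : c / ν ≤ ν + c / ν := by linarith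
    have hcν : 0 ≤ c / ν := by positivity
    have h1 : 8 * Real.pi ^ 2 * (lo / Λ) * (c / ν) * (g₀ * ν / (K + 1)) ^ 2 * (t - s)
        ≤ 8 * Real.pi ^ 2 * (lo / Λ) * (ν + c / ν) * (FunctionSpaces.Torus.freqNormSq ℓ / (n:ℝ) ^ 2) * (t - s) := by
      have hA : 0 ≤ 8 * Real.pi ^ 2 * (lo / Λ) := by positivity
      have h2 : 8 * Real.pi ^ 2 * (lo / Λ) * (c / ν) ≤ 8 * Real.pi ^ 2 * (lo / Λ) * (ν + c / ν) := mul_le_mul_of_nonneg_left hB hA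
      have h3 : 0 ≤ 8 * Real.pi ^ 2 * (lo / Λ) * (ν + c / ν) := by positivity
      exact mul_le_mul_of_nonneg_right (mul_le_mul h2 hQ (by positivity) h3) hτ.le
    have h2 : 8 * Real.pi ^ 2 * (lo / Λ) * (c / ν) * (g₀ * ν / (K + 1)) ^ 2 * (t - s)
        = 8 * Real.pi ^ 2 * (lo / Λ) * c * g₀ ^ 2 / (K + 1) ^ 2 * (ν * (t - s)) := by
      field_simp
    have h3 : rH ≤ 8 * Real.pi ^ 2 * (lo / Λ) * c * g₀ ^ 2 / (K + 1) ^ 2 * (ν * (t - s)) := by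
      have e3 : rH = 8 * Real.pi ^ 2 * (lo / Λ) * c * g₀ ^ 2 / (K + 1) ^ 2 * (M * W.period) := by
        rw [hrH]; field_simp
      rw [e3]
      exact mul_le_mul_of_nonneg_left hντ.le (by positivity)
    have h4 : 8 * Real.pi ^ 2 * (lo / Λ) * (ν + c / ν) * (FunctionSpaces.Torus.freqNormSq ℓ / (n:ℝ) ^ 2) * (t - s)
        = 8 * Real.pi ^ 2 * (1 / (n:ℝ) ^ 2 * ((ν + c / ν) * (lo / Λ))) * FunctionSpaces.Torus.freqNormSq ℓ * (t - s) := by ring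
    have hexp : rH ≤ 8 * Real.pi ^ 2 * (1 / (n:ℝ) ^ 2 * ((ν + c / ν) * (lo / Λ))) * FunctionSpaces.Torus.freqNormSq ℓ * (t - s) := by
      rw [← h4]; linarith [h1, h2, h3]
    unfold dW loT
    have := Real.exp_le_exp.2 (neg_le_neg hexp)
    rw [hdH]; linarith
  have hsdW : Real.sqrt dH ≤ Real.sqrt (dW lo Λ c ν n (t - s) ℓ) := Real.sqrt_le_sqrt hdW
  -- ### the two regimes in ν
  have hwζ : 0 ≤ ‖w‖ * ‖ζ‖ := by positivity
  have key : |⟪U s t w, ζ⟫_ℝ| ≤ η * Real.sqrt dH * ‖w‖ * ‖ζ‖ := by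
    by_cases hνh' : ν < νh
    · -- W7 at general phase
      have hν' : ν ∈ Set.Ioo 0 νh := ⟨hν.1, hνh'⟩
      have hdec := norm_apply_le_of_highLabelDecay_anyPhase W M hM hW7 hlo (by linarith) hΛ1 hCK0 hcK.le hν' hn1' hodd hwin
        (U := U) hU hs hlong.le htT hLpos hKL hℓ0 le_rfl hℓn w hwcp
      -- `√CK e^{a} e^{−cKν(t−s)} ≤ C₂ x^{e} √dH`
      have hkill : Real.sqrt CK * Real.exp a * Real.exp (-(cK * ν * (t - s))) ≤ C₂ * x ^ e σ * Real.sqrt dH := by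
        have e1 : cK * ν * (t - s) = a / x := by
          rw [ha, hx, ← hνP]; field_simp
        rw [e1]
        have h1 := exp_neg_div_le_rpow_div_sqrt ha0 hx0 hx1 he1
        have h2 : Real.sqrt CK * Real.exp a * Real.exp (-(a / x)) ≤ Real.sqrt CK * Real.exp a * (x ^ e σ / Real.sqrt a) :=
          mul_le_mul_of_nonneg_left h1 (by positivity)
        have h3 : Real.sqrt CK * Real.exp a * (x ^ e σ / Real.sqrt a)
            = (Real.sqrt CK * Real.exp a / (Real.sqrt a * Real.sqrt dH)) * x ^ e σ * Real.sqrt dH := by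
          field_simp
        rw [h3] at h2
        exact h2.trans (mul_le_mul_of_nonneg_right (mul_le_mul_of_nonneg_right hC₂a hxe0) hsdH.le)
      calc |⟪U s t w, ζ⟫_ℝ| ≤ ‖U s t w‖ * ‖ζ‖ := abs_real_inner_le_norm _ _
        _ ≤ (Real.sqrt CK * Real.exp (cK * (M * W.period)) * Real.exp (-(cK * ν * (t - s))) * ‖w‖) * ‖ζ‖ :=
            mul_le_mul_of_nonneg_right hdec (norm_nonneg _)
        _ = (Real.sqrt CK * Real.exp a * Real.exp (-(cK * ν * (t - s)))) * (‖w‖ * ‖ζ‖) := by rw [ha]; ring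
        _ ≤ (C₂ * x ^ e σ * Real.sqrt dH) * (‖w‖ * ‖ζ‖) := mul_le_mul_of_nonneg_right hkill hwζ
        _ ≤ (η * Real.sqrt dH) * (‖w‖ * ‖ζ‖) := mul_le_mul_of_nonneg_right (mul_le_mul_of_nonneg_right hη_cap hsdH.le) hwζ
        _ = η * Real.sqrt dH * ‖w‖ * ‖ζ‖ := by ring
    · -- the floor pays: `1 ≤ C₂² ν^{e} √dH`
      rw [not_lt] at hνh'
      have hνh1 : νh ≤ 1 := hνh'.trans hν1
      have hνe : Real.sqrt νh ≤ ν ^ e σ := by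
        calc Real.sqrt νh ≤ Real.sqrt ν := Real.sqrt_le_sqrt hνh'
          _ = ν ^ (1 / 2 : ℝ) := Real.sqrt_eq_rpow ν
          _ ≤ ν ^ e σ := Real.rpow_le_rpow_of_exponent_ge hν.1 hν1 he1
      have hfloor : 1 ≤ C₂ * (C₂ * ν ^ e σ) * Real.sqrt dH := by
        -- `C₂ ≥ 1`, `C₂ ≥ 1/(νh dH)`, `ν^e ≥ √νh`, and `√νh·√dH ≤ 1`
        have h1 : 1 / (νh * dH) * Real.sqrt νh * Real.sqrt dH ≤ C₂ * ν ^ e σ * Real.sqrt dH :=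
          mul_le_mul_of_nonneg_right (mul_le_mul hC₂b hνe (Real.sqrt_nonneg _) hC₂0) hsdH.le
        have h2 : 1 ≤ 1 / (νh * dH) * Real.sqrt νh * Real.sqrt dH := by
          have hs1 : Real.sqrt νh * Real.sqrt dH ≤ 1 := by
            rw [← Real.sqrt_mul hνh.le, Real.sqrt_le_one]; nlinarith
          have hs0 : 0 < Real.sqrt νh * Real.sqrt dH := mul_pos (Real.sqrt_pos.2 hνh) hsdH
          rw [mul_assoc, div_mul_eq_mul_div, one_mul, le_div_iff₀ (mul_pos hνh hdH0)]
          have e2 : νh * dH = (Real.sqrt νh * Real.sqrt dH) ^ 2 := by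
            rw [mul_pow, Real.sq_sqrt hνh.le, Real.sq_sqrt hdH0.le]
          rw [e2]; nlinarith
        have h3 : C₂ * ν ^ e σ * Real.sqrt dH ≤ C₂ * (C₂ * ν ^ e σ) * Real.sqrt dH := by
          have : C₂ * ν ^ e σ ≤ C₂ * (C₂ * ν ^ e σ) := by
            have h0 : 0 ≤ C₂ * ν ^ e σ := mul_nonneg hC₂0 (Real.rpow_nonneg hν.1.le _)
            nlinarith
          exact mul_le_mul_of_nonneg_right this hsdH.le
        linarith
      calc |⟪U s t w, ζ⟫_ℝ| ≤ ‖U s t w‖ * ‖ζ‖ := abs_real_inner_le_norm _ _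
        _ ≤ ‖w‖ * ‖ζ‖ := mul_le_mul_of_nonneg_right (hU.norm_le s t w) (norm_nonneg _)
        _ ≤ (C₂ * (C₂ * ν ^ e σ) * Real.sqrt dH) * (‖w‖ * ‖ζ‖) := le_mul_of_one_le_left hwζ hfloor
        _ ≤ (η * Real.sqrt dH) * (‖w‖ * ‖ζ‖) := mul_le_mul_of_nonneg_right (mul_le_mul_of_nonneg_right hη_floor hsdH.le) hwζ
        _ = η * Real.sqrt dH * ‖w‖ * ‖ζ‖ := by ring
  -- ### conclusion
  rw [hmin]
  calc |⟪U s t w, ζ⟫_ℝ| ≤ η * Real.sqrt dH * ‖w‖ * ‖ζ‖ := key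
    _ ≤ η * Real.sqrt (dW lo Λ c ν n (t - s) ℓ) * ‖w‖ * ‖ζ‖ := by gcongr
    _ = _ := by rw [hη, hX]

end Summit.AnomalousDissipation.AnomalousDissipation.Theorems.SolenoidalFractalHomogenisation.LagrangianStep.VmodFlat

end
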